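import Summits.QuantumFields.YangMills.Theses.PoincareLipschitz
import Literature.MathematicalPhysics.QuantumFieldTheory.Balaban1983to89.T4AxialGaugeSmallField
import HarnessLib

/-!
# LINE 29 «CombPeierls» — SKELETON v1: the BOUNDED-BOX rung of K1′ `MesoscopicConcentrationL` WITHOUT conditioning on the exterior

Cell `ym3-torus` (YM ladder rung R3 = continuum SU(2) Yang–Mills on T³ — a RUNG, NOT d = 4, NOT infinite volume, NOT a mass gap, NOT Clay).
Ideator seat `ym-r3-idea-2` g16, lens «nearmiss».  Crux of record `UnitScaleTilt.HistoryTailL` (stmt-QuantumFields-19936, the seat's write slot); this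
line's CONCLUSION BY NAME is `PoincareLipschitz.MesoscopicConcentrationL` (stmt-QuantumFields-23532, K1′ of route PoincareLipschitz, rank 2, NO workfiles
so far), reached as
  three CombPeierls stubs ⟹ the crux ON BOUNDED BOXES `n ≤ 17·L³` (= LINE 23's BC5 plan-only first rung `stub_boundedBoxConcentration`, here DECOMPOSED)
  and, with LINE 23's hardest stub `stub_mesoscopicBoxConcentration` (boxes `17·L³ < n ≤ β_K`; organ-adjacent; imported VERBATIM as the residual) ⟹ the crux.

THE NEAR-MISS.  LINE 23's plan for the bounded-box rung (card `Lines/poincare-lipschitz.md`): condition on the exterior of the box, axial gauge, uniform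
convexity of `β_K·S_box` near its minimiser, Bakry–Émery on `SU(2)^bonds` (Ric > 0), conditional LSI, Herbst.  Its MEASURED DEFICIT (this seat, NOTES
«ConvexCore»): the conditional Gaussian concentration is fine, but the crux centres at the GLOBAL mean `∫f`, and the exterior-induced shift of the conditional
mean `E[f | ext] − ∫f` is controlled at the Gaussian scale `nΛ/√β_K` only by a GLOBAL weak-coupling regularity statement (massless exterior influence;
LINE 23's own «rough exteriors» worry) — organ-adjacent.  THE SINGLE INPUT TO IMPROVE: DO NOT CONDITION.  For a bounded box every gauge-invariant box-local
Λ-Lipschitz `f` is, deterministically, within `Λ·4n³·δ` of the constant `f(𝟙)` whenever all box plaquettes are `δ`-small (complete axial gauge on the box's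
comb tree: ✓`T4AxialGaugeSmallField.dist1_gaugeAct_axialGauge_le_uniform`; `stub_axialCombTransfer`), so the tail of `f − ∫f` is the tail of the LARGEST BOX
PLAQUETTE (union bound + centring at `f(𝟙)`: `stub_boxTailBookkeeping`), and the one measure-side input is a β-UNIFORM single-plaquette sub-Gaussian tail
`μ_K{s ≤ dist₁(U(∂p))} ≤ C₀·e^{−κ₀β_K s²}` with first moment `≤ K₁/√β_K` (`stub_uniformPlaquetteTail`).  The tree HAS the chessboard tail with the entropy
prefactor `√β^{9}` (✓`T3FinestHeightTail.gibbsMeasure_real_dist1_ge_le`, FILS + link ball); β-UNIFORMITY (no prefactor) is this line's NEW INPUT and is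
NECESSARY (a `log β_K` in the centring radius is incompatible with the crux's β-independent `Cc`): it follows from the chessboard estimate once the
constrained partition function keeps its Gaussian factor, i.e. from the TWO-SIDED TREE-GAUGE FREE-ENERGY BOUND `log Z(β) = −(3/2)·(#cotree bonds − 3)·log β
+ O(N³)` (upper: shelling of the cotree bonds by coordinate plaquettes + Haar invariance; lower: the `β^{−1/2}`-ball in tree gauge with the three torus
holonomies free) — so `Z(β/2)/Z(β) = e^{O(N³)}` and the `N³`-th root is β-free.  For bounded boxes all `n`-dependence (`n⁴`, `(n+1)¹⁰`) is absorbed into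
`Cc(L), cc(L)`; the composition below is elementary real arithmetic (two r-regimes; `β_K ≥ n ≥ 1` from the crux's own hypothesis).

HONEST SCOPE.  The mechanism covers ONLY bounded boxes (`n ≤ 17·L³`, LINE 23's rung); boxes `17·L³ < n ≤ β_K` are the residual stub = LINE 23's hardest,
organ-adjacent stub, imported verbatim (shared signature) and NOT claimed.  No summit, rung, crux or stub is proved here; five… no: FOUR sorries, all in
`stub_*`.  Stubs are stated over Literature/Theses/Mathlib declarations only.

REGISTRATION.  Written to `Cruxes/HistoryTailL/Lines/comb_peierls.lean` (write slot of 19936); registered `--crux stmt-QuantumFields-23532` (free slot; NEVER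
on 19936 = LINE 24 / 23133 = LINE 27 / 23083 = LINE 28 / 25567 / 23533).
-/

open scoped BigOperators
open MeasureTheory
open Literature.MathematicalPhysics.QuantumFieldTheory.Balaban1983to89
open Literature.MathematicalPhysics.QuantumFieldTheory.Balaban1983to89.T3ContinuumYM3Torus
open Literature.MathematicalPhysics.QuantumFieldTheory.Balaban1983to89.T3UnitScaleTilt
open Literature.MathematicalPhysics.QuantumFieldTheory.Balaban1983to89.T3UnitLawDensityEML (ℰp)
open Literature.MathematicalPhysics.QuantumFieldTheory.Balaban1983to89.T4AxialGaugeSmallField (boxPlaqs castSite axialGauge)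

namespace Summit.QuantumFields.YangMills.Cruxes.HistoryTailL.CombPeierls

/-! ## §1 The three CombPeierls stubs (the line's mechanism) -/

/-- **stub_uniformPlaquetteTail (M, HARDEST of the mechanism; the NEW input).**  β-UNIFORM single-plaquette sub-Gaussian tail and first moment under the
level-K unit-lattice Wilson Gibbs measure `gibbsK`: for each `L` there are `C₀ ≥ 0`, `κ₀ > 0`, `K₁ ≥ 0`, `γ₁ ∈ (0,1]` with
`μ_K{s ≤ dist₁(U(∂p))} ≤ C₀·exp(−κ₀·β_K·s²)` for all `s ≥ 0` and `∫ dist₁(U(∂p)) dμ_K ≤ K₁/√β_K`, for every family (`F.L = L`), `0 < γ ≤ γ₁`, level `K`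
and plaquette `p` — NO power of `β_K` in front.  MECHANISM: chessboard (✓`T3FinestHeightTail.gibbsMeasure_real_dist1_ge_le` carries `√β^{9}`) with the
Gaussian factor KEPT in the constrained partition function: `Z_A ≤ e^{−(β/2)c s²·N_A}·Z(β/2)` and the two-sided tree-gauge free-energy bound
`|log Z(β) + (3/2)(#cotree − 3) log β| ≤ C·N³` (shelling upper bound, tree-gauge small-ball lower bound with free holonomies) ⇒ `Z(β/2)/Z(β) ≤ e^{C'N³}`,
`N_A = N³` ⇒ β-free constant; the first moment by the layer-cake formula.  WHY IT MIGHT FAIL: the O(N³) constant of the LOWER free-energy bound must be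
β-uniform on the EVEN torus `(2L^{m+K})³` including the seam plaquettes next to the three free holonomies (conjugation keeps them small — to be checked in
the kernel); RP-compatibility of the plaquette event on the even torus is the tree's (`WilsonPlaquetteChessboardTail`).  SIZE M.
Sources: Fröhlich–Israel–Lieb–Simon CMP 62 (1978) Thm 4.1/§4; [Balaban1985UV3] (11) p.258, (71) p.273; L. Gross CMP 92 (1983) Thm 3.6 (abelian shape). -/
theorem stub_uniformPlaquetteTail :
    ∀ (L : ℕ), ∃ (C₀ κ₀ K₁ : ℝ), 0 ≤ C₀ ∧ 0 < κ₀ ∧ 0 ≤ K₁ ∧ ∃ γ₁ : ℝ, 0 < γ₁ ∧ γ₁ ≤ 1 ∧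
      ∀ (F : T3Family) (γ : ℝ), F.L = L → 0 < γ → γ ≤ γ₁ → ∀ (K : ℕ) (p : Plaq (F.P K) 0),
        (∀ s : ℝ, 0 ≤ s →
          (gibbsK F ℰp γ K).real {U | s ≤ GaugeGroup.dist1 (GaugeField.plaqHol U p)}
            ≤ C₀ * Real.exp (-(κ₀ * (F.scheme ℰp γ).β K * s ^ 2))) ∧
        ∫ U, GaugeGroup.dist1 (GaugeField.plaqHol U p) ∂(gibbsK F ℰp γ K) ≤ K₁ / Real.sqrt ((F.scheme ℰp γ).β K) := by
  sorry

/-- **stub_axialCombTransfer (S–M, deterministic comb geometry).**  For a box of side `n` at `x₀` (`1 ≤ n`, `2n ≤ sitesPerDir`, so no wrap-around), a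
GAUGE-INVARIANT, BOX-LOCAL (depends only on bonds with both ends in the box), Λ-link-Lipschitz `f`: (i) the box has at most `3(n+1)³` plaquettes
(`boxPlaqs lo hi`, `lo = x₀`, `hi = x₀ + (n−1)` in integer coordinates); (ii) if every box plaquette is `δ`-small then `|f(U) − f(𝟙)| ≤ Λ·4n³·δ`.
MECHANISM: `f(U) = f(U^g)` for the complete axial gauge `g = axialGauge U lo hi` (gauge invariance); box-locality replaces `U^g` by the field equal to `U^g` on
box bonds and `1` elsewhere; ✓`dist1_gaugeAct_axialGauge_le_uniform` bounds each box bond of `U^g` by `(d−1)(n−1)δ = 2(n−1)δ`; at most `3n³` box bonds ⇒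
`Λ·√(3n³)·2(n−1)δ ≤ Λ·4n³·δ`.  WHY IT MIGHT FAIL: only bookkeeping — the ZMod box `(b.src k − x₀ k).val < n` must be matched with `boxBonds lo hi`
(needs `n < sitesPerDir`, given by `2n ≤ sitesPerDir`, `1 ≤ n`).  SIZE S–M.
Sources: ✓`T4AxialGaugeSmallField` §2 [folklore, Creutz «Quarks, gluons and lattices» ch. 9 (maximal-tree gauge)]; ✓`UnitScaleGibbsBoxPeierlsPolynomial.card_filter_mem_boxPlaqs_le` (count). -/
theorem stub_axialCombTransfer :
    ∀ (F : T3Family) (K n : ℕ) (x₀ : Site (F.P K) 0)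
      (f : GaugeField (F.P K) 0 (Matrix.specialUnitaryGroup (Fin 2) ℂ) → ℝ) (Λ : ℝ), 0 ≤ Λ → 1 ≤ n → 2 * n ≤ (F.P K).sitesPerDir 0 →
      GaugeField.GaugeInvariant f →
      (∀ U U' : GaugeField (F.P K) 0 (Matrix.specialUnitaryGroup (Fin 2) ℂ),
        (∀ b : PBond (F.P K) 0, (∀ k, (b.src k - x₀ k).val < n) → (∀ k, (b.tgt k - x₀ k).val < n) → U b = U' b) → f U = f U') →
      (∀ U U' : GaugeField (F.P K) 0 (Matrix.specialUnitaryGroup (Fin 2) ℂ),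
        |f U - f U'| ≤ Λ * Real.sqrt (∑ b : PBond (F.P K) 0, GaugeGroup.dist1 (U b * (U' b)⁻¹) ^ 2)) →
      ((boxPlaqs (P := F.P K) (j := 0) (fun k => ((x₀ k).val : ℤ)) (fun k => ((x₀ k).val : ℤ) + ((n : ℤ) - 1))).ncard : ℝ)
          ≤ 3 * ((n : ℝ) + 1) ^ 3 ∧
      ∀ (U : GaugeField (F.P K) 0 (Matrix.specialUnitaryGroup (Fin 2) ℂ)) (δ : ℝ), 0 < δ →
        PlaqSmallOn (boxPlaqs (fun k => ((x₀ k).val : ℤ)) (fun k => ((x₀ k).val : ℤ) + ((n : ℤ) - 1))) δ U →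
        |f U - f (fun _ => 1)| ≤ Λ * (4 * (n : ℝ) ^ 3) * δ := by
  sorry

/-- **stub_boxTailBookkeeping (M, pure measure theory; no physics).**  Under `μ_K = gibbsK` (a probability measure): if a measurable `g` is pinned to a
constant `g₁` by the plaquettes of a set `S` — `|g(U) − g₁| ≤ M·δ` whenever all `p ∈ S` are `δ`-small — and every `p ∈ S` has the sub-Gaussian tail
`μ_K{s ≤ dist₁(U(∂p))} ≤ C₀e^{−κs²}` and first moment `≤ m₁`, then for `r ≥ 2·M·NS·m₁` (`NS ≥ #S`), `r > 0`:
`μ_K{r ≤ g − ∫g} ≤ NS·C₀·exp(−κ(r/(2M))²)`.  MECHANISM: centring `|∫g − g₁| ≤ ∫|g − g₁| ≤ M·Σ_{p∈S}∫dist₁ ≤ M·NS·m₁` (g bounded ⇒ integrable); on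
`{r ≤ g − ∫g}` some `p ∈ S` has `dist₁ ≥ r/(2M)` (else `PlaqSmallOn S δ` for some `δ < r/(2M)`); union bound (`measureReal_biUnion_finset_le`).
WHY IT MIGHT FAIL: only bookkeeping (integrability of `g` from the pinning bound and `dist₁ ≤ 2`).  SIZE M.
Sources: Mathlib `MeasureTheory.measureReal_biUnion_finset_le`, `MeasureTheory.integral_mono`; Ledoux, «The concentration of measure phenomenon» (2001) §1.1 (union/centring bookkeeping). -/
theorem stub_boxTailBookkeeping :
    ∀ (F : T3Family) (γ : ℝ), 0 < γ → ∀ (K : ℕ) (S : Set (Plaq (F.P K) 0)) (NS : ℝ)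
      (g : GaugeField (F.P K) 0 (Matrix.specialUnitaryGroup (Fin 2) ℂ) → ℝ) (g₁ M C₀ κ m₁ : ℝ),
      Measurable g → 0 < M → 0 ≤ C₀ → 0 < κ → 0 ≤ m₁ → (S.ncard : ℝ) ≤ NS →
      (∀ (U : GaugeField (F.P K) 0 (Matrix.specialUnitaryGroup (Fin 2) ℂ)) (δ : ℝ), 0 < δ → PlaqSmallOn S δ U → |g U - g₁| ≤ M * δ) →
      (∀ p ∈ S, ∀ s : ℝ, 0 ≤ s →
        (gibbsK F ℰp γ K).real {U | s ≤ GaugeGroup.dist1 (GaugeField.plaqHol U p)} ≤ C₀ * Real.exp (-(κ * s ^ 2))) →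
      (∀ p ∈ S, ∫ U, GaugeGroup.dist1 (GaugeField.plaqHol U p) ∂(gibbsK F ℰp γ K) ≤ m₁) →
      ∀ r : ℝ, 0 < r → 2 * (M * NS * m₁) ≤ r →
        (gibbsK F ℰp γ K).real {U | r ≤ g U - ∫ V, g V ∂(gibbsK F ℰp γ K)} ≤ NS * C₀ * Real.exp (-(κ * (r / (2 * M)) ^ 2)) := by
  sorry

/-! ## §2 The residual, imported VERBATIM (shared signature with LINE 23's hardest stub; organ-adjacent; NOT this line's mechanism) -/

/-- **stub_mesoscopicBoxConcentration (XL, RESIDUAL, organ-adjacent — HONESTLY NOT this line's mechanism).**  `MesoscopicConcentrationL` restricted to boxes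
`17·L³ < n ≤ β_K` — token-identical with LINE 23's registered `stub_mesoscopicBoxConcentration` (`Lines/poincare_lipschitz.lean`), so one proof closes both.
WHY IT MIGHT FAIL: a β-uniform Gaussian concentration at the Poincaré scale `n²/β_K` for boxes up to the confinement scale `n ≍ β_K` is a multiscale
functional inequality at weak coupling (Bauerschmidt–Bodineau type), not in print for non-abelian gauge theories; Gribov/non-convexity.
Sources: LINE 23 card `Lines/poincare-lipschitz.md`; arXiv:2204.12737 §3; arXiv:1907.13516 (multiscale Bakry–Émery). -/
theorem stub_mesoscopicBoxConcentration :
    open Literature.MathematicalPhysics.QuantumFieldTheory.Balaban1983to89 Literature.MathematicalPhysics.QuantumFieldTheory.Balaban1983to89.T3ContinuumYM3Torus in ∀ (L : ℕ), ∃ (Cc cc : ℝ), 0 ≤ Cc ∧ 0 < cc ∧ ∃ γ₁ : ℝ, 0 < γ₁ ∧ γ₁ ≤ 1 ∧ ∀ (F : T3Family) (γ : ℝ), F.L = L → 0 < γ → γ ≤ γ₁ → ∀ (K n : ℕ), 1 ≤ n → (n : ℝ) ≤ (F.scheme T3UnitLawDensityEML.ℰp γ).β K → 2 * n ≤ (F.P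 K).sitesPerDir 0 → 17 * L ^ 3 < n → ∀ (x₀ : Site (F.P K) 0) (f : GaugeField (F.P K) 0 (Matrix.specialUnitaryGroup (Fin 2) ℂ) → ℝ) (Λ : ℝ), 0 < Λ → Measurable f → GaugeField.GaugeInvariant f → (∀ U U' : GaugeField (F.P K) 0 (Matrix.specialUnitaryGroup (Fin 2) ℂ), (∀ b : PBond (F.P K) 0, (∀ k, (b.src k - x₀ k).val < n) → (∀ k, (b.tgt k - x₀ k).val < n) → U b = U' b) → f U = f U') → (∀ U U' : GaugeField (F.P K) 0 (Matrix.specialUnitaryGroup (Fin 2) ℂ), |f U - f U'| ≤ Λ * Real.sqrt (∑ b : PBond (F.P K) 0, GaugeGroup.dist1 (U b * (U' b)⁻¹) ^ 2)) → ∀ r : ℝ, 0 ≤ r → (T3UnitScaleTilt.gibbsK F T3UnitLawDensityEML.ℰp γ K).real {U | r ≤ f U - ∫ V, f V ∂(T3UnitScaleTilt.gibbsK F T3UnitLawDensityEML.ℰp γ K)} ≤ Cc * Real.exp (-(cc * (F.scheme T3UnitLawDensityEML.ℰp γ).β K * r ^ 2 / ((n : ℝ) ^ 2 * Λ ^ 2)))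 := by
  sorry


/-! ## §3 Composition, part 1 (sorry-free): the three CombPeierls stubs ⟹ the BOUNDED-BOX rung (`n ≤ 17·L³`; statement token-identical with LINE 23's
BC5 plan-only `stub_boundedBoxConcentration`) — elementary real arithmetic in two `r`-regimes; `β_K ≥ n ≥ 1` is the crux's own hypothesis. -/

set_option maxHeartbeats 1600000 in
/-- KERNEL (bounded boxes): `stub_uniformPlaquetteTail → stub_axialCombTransfer → stub_boxTailBookkeeping →` the bounded-box rung.  Constants:
`N₀ = 17L³ + 1`, `cc = κ₀/(64·N₀⁴)`, `E₀ = 576·cc·K₁²·N₀¹⁰`, `Cc = (3N₀³C₀ + 1)·e^{E₀}`, `γ₁` of the tail stub.  Regime `r ≥ 2δ₀`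
(`δ₀ = Λ·4n³·3(n+1)³·K₁/√β_K`): the bookkeeping stub; regime `r < 2δ₀`: the bound is `≥ 1` because `β_K` cancels in `cc·β_K·(2δ₀)²/(n²Λ²) ≤ E₀`. -/
theorem boundedBoxConcentration_of
    (hP : ∀ (L : ℕ), ∃ (C₀ κ₀ K₁ : ℝ), 0 ≤ C₀ ∧ 0 < κ₀ ∧ 0 ≤ K₁ ∧ ∃ γ₁ : ℝ, 0 < γ₁ ∧ γ₁ ≤ 1 ∧
      ∀ (F : T3Family) (γ : ℝ), F.L = L → 0 < γ → γ ≤ γ₁ → ∀ (K : ℕ) (p : Plaq (F.P K) 0),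
      (∀ s : ℝ, 0 ≤ s →
      (gibbsK F ℰp γ K).real {U | s ≤ GaugeGroup.dist1 (GaugeField.plaqHol U p)}
      ≤ C₀ * Real.exp (-(κ₀ * (F.scheme ℰp γ).β K * s ^ 2))) ∧
      ∫ U, GaugeGroup.dist1 (GaugeField.plaqHol U p) ∂(gibbsK F ℰp γ K) ≤ K₁ / Real.sqrt ((F.scheme ℰp γ).β K))
    (hD : ∀ (F : T3Family) (K n : ℕ) (x₀ : Site (F.P K) 0)
      (f : GaugeField (F.P K) 0 (Matrix.specialUnitaryGroup (Fin 2) ℂ) → ℝ) (Λ : ℝ), 0 ≤ Λ → 1 ≤ n → 2 * n ≤ (F.P K).sitesPerDir 0 →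
      GaugeField.GaugeInvariant f →
      (∀ U U' : GaugeField (F.P K) 0 (Matrix.specialUnitaryGroup (Fin 2) ℂ),
      (∀ b : PBond (F.P K) 0, (∀ k, (b.src k - x₀ k).val < n) → (∀ k, (b.tgt k - x₀ k).val < n) → U b = U' b) → f U = f U') →
      (∀ U U' : GaugeField (F.P K) 0 (Matrix.specialUnitaryGroup (Fin 2) ℂ),
      |f U - f U'| ≤ Λ * Real.sqrt (∑ b : PBond (F.P K) 0, GaugeGroup.dist1 (U b * (U' b)⁻¹) ^ 2)) →
      ((boxPlaqs (P := F.P K) (j := 0) (fun k => ((x₀ k).val : ℤ)) (fun k => ((x₀ k).val : ℤ) + ((n : ℤ) - 1))).ncard : ℝ)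
      ≤ 3 * ((n : ℝ) + 1) ^ 3 ∧
      ∀ (U : GaugeField (F.P K) 0 (Matrix.specialUnitaryGroup (Fin 2) ℂ)) (δ : ℝ), 0 < δ →
      PlaqSmallOn (boxPlaqs (fun k => ((x₀ k).val : ℤ)) (fun k => ((x₀ k).val : ℤ) + ((n : ℤ) - 1))) δ U →
      |f U - f (fun _ => 1)| ≤ Λ * (4 * (n : ℝ) ^ 3) * δ)
    (hB : ∀ (F : T3Family) (γ : ℝ), 0 < γ → ∀ (K : ℕ) (S : Set (Plaq (F.P K) 0)) (NS : ℝ)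
      (g : GaugeField (F.P K) 0 (Matrix.specialUnitaryGroup (Fin 2) ℂ) → ℝ) (g₁ M C₀ κ m₁ : ℝ),
      Measurable g → 0 < M → 0 ≤ C₀ → 0 < κ → 0 ≤ m₁ → (S.ncard : ℝ) ≤ NS →
      (∀ (U : GaugeField (F.P K) 0 (Matrix.specialUnitaryGroup (Fin 2) ℂ)) (δ : ℝ), 0 < δ → PlaqSmallOn S δ U → |g U - g₁| ≤ M * δ) →
      (∀ p ∈ S, ∀ s : ℝ, 0 ≤ s →
      (gibbsK F ℰp γ K).real {U | s ≤ GaugeGroup.dist1 (GaugeField.plaqHol U p)} ≤ C₀ * Real.exp (-(κ * s ^ 2))) →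
      (∀ p ∈ S, ∫ U, GaugeGroup.dist1 (GaugeField.plaqHol U p) ∂(gibbsK F ℰp γ K) ≤ m₁) →
      ∀ r : ℝ, 0 < r → 2 * (M * NS * m₁) ≤ r →
      (gibbsK F ℰp γ K).real {U | r ≤ g U - ∫ V, g V ∂(gibbsK F ℰp γ K)} ≤ NS * C₀ * Real.exp (-(κ * (r / (2 * M)) ^ 2))) :
    open Literature.MathematicalPhysics.QuantumFieldTheory.Balaban1983to89 Literature.MathematicalPhysics.QuantumFieldTheory.Balaban1983to89.T3ContinuumYM3Torus in ∀ (L : ℕ), ∃ (Cc cc : ℝ), 0 ≤ Cc ∧ 0 < cc ∧ ∃ γ₁ : ℝ, 0 < γ₁ ∧ γ₁ ≤ 1 ∧ ∀ (F : T3Family) (γ : ℝ), F.L = L → 0 < γ → γ ≤ γ₁ → ∀ (K n : ℕ), 1 ≤ n → (n : ℝ) ≤ (F.scheme T3UnitLawDensityEML.ℰp γ).β K → 2 * n ≤ (F.P K).sitesPerDir 0 → n ≤ 17 * L ^ 3 → ∀ (x₀ : Site (F.P K) 0) (f : GaugeField (F.P K) 0 (Matrix.specialUnitaryGroup (Fin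 2) ℂ) → ℝ) (Λ : ℝ), 0 < Λ → Measurable f → GaugeField.GaugeInvariant f → (∀ U U' : GaugeField (F.P K) 0 (Matrix.specialUnitaryGroup (Fin 2) ℂ), (∀ b : PBond (F.P K) 0, (∀ k, (b.src k - x₀ k).val < n) → (∀ k, (b.tgt k - x₀ k).val < n) → U b = U' b) → f U = f U') → (∀ U U' : GaugeField (F.P K) 0 (Matrix.specialUnitaryGroup (Fin 2) ℂ), |f U - f U'| ≤ Λ * Real.sqrt (∑ b : PBond (F.P K) 0, GaugeGroup.dist1 (U b * (U' b)⁻¹) ^ 2)) → ∀ r : ℝ, 0 ≤ r → (T3UnitScaleTilt.gibbsK F T3UnitLawDensityEML.ℰp γ K).real {U | r ≤ f U - ∫ V, f V ∂(T3UnitScaleTilt.gibbsK F T3UnitLawDensityEML.ℰp γ K)} ≤ Cc * Real.exp (-(cc * (F.scheme T3UnitLawDensityEML.ℰp γ).β K * r ^ 2 / ((n : ℝ) ^ 2 * Λ ^ 2))) := by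
  intro L
  obtain ⟨C₀, κ₀, K₁, hC₀, hκ₀, hK₁, γa, hγa, hγa1, HP⟩ := hP L
  obtain ⟨N₀, hN₀⟩ : ∃ N₀ : ℝ, N₀ = ((17 * L ^ 3 : ℕ) : ℝ) + 1 := ⟨_, rfl⟩
  have hN₀1 : 1 ≤ N₀ := by
    have : (0 : ℝ) ≤ ((17 * L ^ 3 : ℕ) : ℝ) := by positivity
    rw [hN₀]; linarith
  have hN₀0 : 0 < N₀ := by linarith
  obtain ⟨cc, hcc⟩ : ∃ cc : ℝ, cc = κ₀ / (64 * N₀ ^ 4) := ⟨_, rfl⟩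
  have hcc0 : 0 < cc := by rw [hcc]; positivity
  have hccκ : cc * (64 * N₀ ^ 4) = κ₀ := by
    rw [hcc]; exact div_mul_cancel₀ _ (by positivity)
  obtain ⟨E₀, hE₀⟩ : ∃ E₀ : ℝ, E₀ = 576 * cc * K₁ ^ 2 * N₀ ^ 10 := ⟨_, rfl⟩
  have hE₀0 : 0 ≤ E₀ := by rw [hE₀]; positivity
  obtain ⟨Cc, hCc⟩ : ∃ Cc : ℝ, Cc = (3 * N₀ ^ 3 * C₀ + 1) * Real.exp E₀ := ⟨_, rfl⟩
  have hCc0 : 0 ≤ Cc := by rw [hCc]; positivity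
  have hCc1 : Real.exp E₀ ≤ Cc := by
    rw [hCc]
    have h3 : (0 : ℝ) ≤ 3 * N₀ ^ 3 * C₀ := by positivity
    nlinarith [Real.exp_pos E₀]
  refine ⟨Cc, cc, hCc0, hcc0, γa, hγa, hγa1, ?_⟩
  intro F γ hFL hγ hγle K n hn1 hnβ h2n hnL x₀ f Λ hΛ hfm hfG hloc hlip r hr
  -- `β_K ≥ n ≥ 1`
  have hn1r : (1 : ℝ) ≤ (n : ℝ) := by exact_mod_cast hn1
  have hβ1 : (1 : ℝ) ≤ (F.scheme ℰp γ).β K := hn1r.trans hnβ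
  have hβ0 : (0 : ℝ) < (F.scheme ℰp γ).β K := by linarith
  have hn0 : (0 : ℝ) < (n : ℝ) := by linarith
  have hnN₀ : (n : ℝ) + 1 ≤ N₀ := by
    have : (n : ℝ) ≤ ((17 * L ^ 3 : ℕ) : ℝ) := by exact_mod_cast hnL
    rw [hN₀]; linarith
  have hnN₀' : (n : ℝ) ≤ N₀ := by linarith
  haveI := isProbabilityMeasure_gibbsK F ℰp hγ.le K
  -- the comb transfer and the plaquette count for this box
  obtain ⟨hcount, hdet⟩ := hD F K n x₀ f Λ hΛ.le hn1 h2n hfG hloc hlip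
  have hM0 : 0 < Λ * (4 * (n : ℝ) ^ 3) := by positivity
  have hm₁0 : 0 ≤ K₁ / Real.sqrt ((F.scheme ℰp γ).β K) := by positivity
  have hκ0 : 0 < κ₀ * (F.scheme ℰp γ).β K := by positivity
  -- the bookkeeping stub, fed with the β-uniform plaquette tail and first moment
  have HB := hB F γ hγ K _ (3 * ((n : ℝ) + 1) ^ 3) f (f (fun _ => 1)) (Λ * (4 * (n : ℝ) ^ 3)) C₀
    (κ₀ * (F.scheme ℰp γ).β K) (K₁ / Real.sqrt ((F.scheme ℰp γ).β K)) hfm hM0 hC₀ hκ0 hm₁0 hcount hdet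
    (fun p _ s hs => (HP F γ hFL hγ hγle K p).1 s hs) (fun p _ => (HP F γ hFL hγ hγle K p).2)
  by_cases hreg : 0 < r ∧ 2 * (Λ * (4 * (n : ℝ) ^ 3) * (3 * ((n : ℝ) + 1) ^ 3) * (K₁ / Real.sqrt ((F.scheme ℰp γ).β K))) ≤ r
  · -- Gaussian regime: union bound over the box plaquettes
    have h1 := HB r hreg.1 hreg.2
    refine h1.trans ?_
    have hpre : 3 * ((n : ℝ) + 1) ^ 3 * C₀ ≤ Cc := by
      have hexp1 : (1 : ℝ) ≤ Real.exp E₀ := by linarith [Real.add_one_le_exp E₀]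
      calc 3 * ((n : ℝ) + 1) ^ 3 * C₀ ≤ 3 * N₀ ^ 3 * C₀ := by gcongr
      _ ≤ (3 * N₀ ^ 3 * C₀ + 1) * 1 := by linarith
      _ ≤ (3 * N₀ ^ 3 * C₀ + 1) * Real.exp E₀ := by gcongr
      _ = Cc := hCc.symm
    have hexp : Real.exp (-(κ₀ * (F.scheme ℰp γ).β K * (r / (2 * (Λ * (4 * (n : ℝ) ^ 3)))) ^ 2))
        ≤ Real.exp (-(cc * (F.scheme ℰp γ).β K * r ^ 2 / ((n : ℝ) ^ 2 * Λ ^ 2))) := by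
      rw [Real.exp_le_exp, neg_le_neg_iff]
      have hcc4 : cc * (64 * (n : ℝ) ^ 4) ≤ κ₀ := by
        calc cc * (64 * (n : ℝ) ^ 4) ≤ cc * (64 * N₀ ^ 4) := by gcongr
        _ = κ₀ := hccκ
      have hn0' : (n : ℝ) ≠ 0 := hn0.ne'
      have hΛ0' : Λ ≠ 0 := hΛ.ne'
      have e1 : cc * (F.scheme ℰp γ).β K * r ^ 2 / ((n : ℝ) ^ 2 * Λ ^ 2)
          = cc * (64 * (n : ℝ) ^ 4) * ((F.scheme ℰp γ).β K * r ^ 2) / (64 * (n : ℝ) ^ 6 * Λ ^ 2) := by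
        field_simp
      have e2 : κ₀ * (F.scheme ℰp γ).β K * (r / (2 * (Λ * (4 * (n : ℝ) ^ 3)))) ^ 2
          = κ₀ * ((F.scheme ℰp γ).β K * r ^ 2) / (64 * (n : ℝ) ^ 6 * Λ ^ 2) := by
        field_simp; ring
      rw [e1, e2]
      have hden : 0 < 64 * (n : ℝ) ^ 6 * Λ ^ 2 := by positivity
      have hβr : 0 ≤ (F.scheme ℰp γ).β K * r ^ 2 := by positivity
      exact div_le_div_of_nonneg_right (mul_le_mul_of_nonneg_right hcc4 hβr) hden.le
    exact mul_le_mul hpre hexp (Real.exp_pos _).le hCc0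
  · -- trivial regime (`r = 0` or `r < 2δ₀`): the right-hand side is at least `1`
    refine (measureReal_le_one).trans ?_
    have hQE : cc * (F.scheme ℰp γ).β K * r ^ 2 / ((n : ℝ) ^ 2 * Λ ^ 2) ≤ E₀ := by
      rcases not_and_or.1 hreg with hr0 | hlt
      · have hr00 : r = 0 := le_antisymm (not_lt.1 hr0) hr
        rw [hr00]; simpa using hE₀0
      · have hlt' := not_le.mp hlt
        have hr2 : r ^ 2 ≤ (2 * (Λ * (4 * (n : ℝ) ^ 3) * (3 * ((n : ℝ) + 1) ^ 3) * (K₁ / Real.sqrt ((F.scheme ℰp γ).β K)))) ^ 2 :=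
          pow_le_pow_left₀ hr hlt'.le 2
        have hm1sq : (K₁ / Real.sqrt ((F.scheme ℰp γ).β K)) ^ 2 = K₁ ^ 2 / (F.scheme ℰp γ).β K := by
          rw [div_pow, Real.sq_sqrt hβ0.le]
        have hn0' : (n : ℝ) ≠ 0 := hn0.ne'
        have hΛ0' : Λ ≠ 0 := hΛ.ne'
        have hβ0' : (F.scheme ℰp γ).β K ≠ 0 := hβ0.ne'
        have key : cc * (F.scheme ℰp γ).β K * (2 * (Λ * (4 * (n : ℝ) ^ 3) * (3 * ((n : ℝ) + 1) ^ 3) * (K₁ / Real.sqrt ((F.scheme ℰp γ).β K)))) ^ 2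
              / ((n : ℝ) ^ 2 * Λ ^ 2) = 576 * cc * K₁ ^ 2 * ((n : ℝ) ^ 4 * ((n : ℝ) + 1) ^ 6) := by
          rw [show (2 * (Λ * (4 * (n : ℝ) ^ 3) * (3 * ((n : ℝ) + 1) ^ 3) * (K₁ / Real.sqrt ((F.scheme ℰp γ).β K)))) ^ 2
              = 576 * Λ ^ 2 * (n : ℝ) ^ 6 * ((n : ℝ) + 1) ^ 6 * (K₁ / Real.sqrt ((F.scheme ℰp γ).β K)) ^ 2 by ring, hm1sq]
          field_simp
        have hpow : (n : ℝ) ^ 4 * ((n : ℝ) + 1) ^ 6 ≤ N₀ ^ 10 := by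
          calc (n : ℝ) ^ 4 * ((n : ℝ) + 1) ^ 6 ≤ N₀ ^ 4 * N₀ ^ 6 :=
                mul_le_mul (pow_le_pow_left₀ hn0.le hnN₀' 4) (pow_le_pow_left₀ (by positivity) hnN₀ 6) (by positivity) (by positivity)
          _ = N₀ ^ 10 := by ring
        calc cc * (F.scheme ℰp γ).β K * r ^ 2 / ((n : ℝ) ^ 2 * Λ ^ 2)
            ≤ cc * (F.scheme ℰp γ).β K * (2 * (Λ * (4 * (n : ℝ) ^ 3) * (3 * ((n : ℝ) + 1) ^ 3) * (K₁ / Real.sqrt ((F.scheme ℰp γ).β K)))) ^ 2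
              / ((n : ℝ) ^ 2 * Λ ^ 2) := by gcongr
        _ = 576 * cc * K₁ ^ 2 * ((n : ℝ) ^ 4 * ((n : ℝ) + 1) ^ 6) := key
        _ ≤ 576 * cc * K₁ ^ 2 * N₀ ^ 10 := by gcongr
        _ = E₀ := hE₀.symm
    have hexpQ : Real.exp (-E₀) ≤ Real.exp (-(cc * (F.scheme ℰp γ).β K * r ^ 2 / ((n : ℝ) ^ 2 * Λ ^ 2))) :=
      Real.exp_le_exp.2 (neg_le_neg hQE)
    calc (1 : ℝ) = Real.exp E₀ * Real.exp (-E₀) := by rw [← Real.exp_add, add_neg_cancel, Real.exp_zero]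
    _ ≤ Cc * Real.exp (-(cc * (F.scheme ℰp γ).β K * r ^ 2 / ((n : ℝ) ^ 2 * Λ ^ 2))) :=
        mul_le_mul hCc1 hexpQ (Real.exp_pos _).le hCc0

/-- BY NAME: the three CombPeierls stubs ⟹ LINE 23's bounded-box rung (token-identical statement). -/
theorem boundedBoxConcentration_of_stubs :
    open Literature.MathematicalPhysics.QuantumFieldTheory.Balaban1983to89 Literature.MathematicalPhysics.QuantumFieldTheory.Balaban1983to89.T3ContinuumYM3Torus in ∀ (L : ℕ), ∃ (Cc cc : ℝ), 0 ≤ Cc ∧ 0 < cc ∧ ∃ γ₁ : ℝ, 0 < γ₁ ∧ γ₁ ≤ 1 ∧ ∀ (F : T3Family) (γ : ℝ), F.L = L → 0 < γ → γ ≤ γ₁ → ∀ (K n : ℕ), 1 ≤ n → (n : ℝ) ≤ (F.scheme T3UnitLawDensityEML.ℰp γ).β K → 2 * n ≤ (F.P K).sitesPerDir 0 → n ≤ 17 * L ^ 3 → ∀ (x₀ : Site (F.P K) 0) (f : GaugeField (F.P K) 0 (Matrix.specialUnitaryGroup (Fin 2) ℂ) → ℝ) (Λ : ℝ), 0 < Λ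 → Measurable f → GaugeField.GaugeInvariant f → (∀ U U' : GaugeField (F.P K) 0 (Matrix.specialUnitaryGroup (Fin 2) ℂ), (∀ b : PBond (F.P K) 0, (∀ k, (b.src k - x₀ k).val < n) → (∀ k, (b.tgt k - x₀ k).val < n) → U b = U' b) → f U = f U') → (∀ U U' : GaugeField (F.P K) 0 (Matrix.specialUnitaryGroup (Fin 2) ℂ), |f U - f U'| ≤ Λ * Real.sqrt (∑ b : PBond (F.P K) 0, GaugeGroup.dist1 (U b * (U' b)⁻¹) ^ 2)) → ∀ r : ℝ, 0 ≤ r → (T3UnitScaleTilt.gibbsK F T3UnitLawDensityEML.ℰp γ K).real {U | r ≤ f U - ∫ V, f V ∂(T3UnitScaleTilt.gibbsK F T3UnitLawDensityEML.ℰp γ K)} ≤ Cc * Real.exp (-(cc * (F.scheme T3UnitLawDensityEML.ℰp γ).β K * r ^ 2 / ((n : ℝ) ^ 2 * Λ ^ 2))) :=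
  boundedBoxConcentration_of stub_uniformPlaquetteTail stub_axialCombTransfer stub_boxTailBookkeeping

/-! ## §4 Composition, part 2 (sorry-free): bounded boxes + the residual ⟹ `MesoscopicConcentrationL` BY NAME -/

/-- GLUE: bounded-box rung `→` residual `→` the TEXT of `MesoscopicConcentrationL` (verbatim signature of stmt-QuantumFields-23532; max/min of the two
constant packages, monotonicity of `x ↦ Cc·e^{−cc·x}`).  The crux BY NAME is concluded only by `MesoscopicConcentrationL_of_stubs` below. -/
theorem mesoscopicConcentrationL_of
    (hbdd :
    open Literature.MathematicalPhysics.QuantumFieldTheory.Balaban1983to89 Literature.MathematicalPhysics.QuantumFieldTheory.Balaban1983to89.T3ContinuumYM3Torus in ∀ (L : ℕ), ∃ (Cc cc : ℝ), 0 ≤ Cc ∧ 0 < cc ∧ ∃ γ₁ : ℝ, 0 < γ₁ ∧ γ₁ ≤ 1 ∧ ∀ (F : T3Family) (γ : ℝ), F.L = L → 0 < γ → γ ≤ γ₁ → ∀ (K n : ℕ), 1 ≤ n → (n : ℝ) ≤ (F.scheme T3UnitLawDensityEML.ℰp γ).β K → 2 * n ≤ (F.P K).sitesPerDir 0 → n ≤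 17 * L ^ 3 → ∀ (x₀ : Site (F.P K) 0) (f : GaugeField (F.P K) 0 (Matrix.specialUnitaryGroup (Fin 2) ℂ) → ℝ) (Λ : ℝ), 0 < Λ → Measurable f → GaugeField.GaugeInvariant f → (∀ U U' : GaugeField (F.P K) 0 (Matrix.specialUnitaryGroup (Fin 2) ℂ), (∀ b : PBond (F.P K) 0, (∀ k, (b.src k - x₀ k).val < n) → (∀ k, (b.tgt k - x₀ k).val < n) → U b = U' b) → f U = f U') → (∀ U U' : GaugeField (F.P K) 0 (Matrix.specialUnitaryGroup (Fin 2) ℂ), |f U - f U'| ≤ Λ * Real.sqrt (∑ b : PBond (F.P K) 0, GaugeGroup.dist1 (U b * (U' b)⁻¹) ^ 2)) → ∀ r : ℝ, 0 ≤ r → (T3UnitScaleTilt.gibbsK F T3UnitLawDensityEML.ℰp γ K).real {U | r ≤ f U - ∫ V, f V ∂(T3UnitScaleTilt.gibbsK F T3UnitLawDensityEML.ℰp γ K)} ≤ Cc * Real.exp (-(cc * (F.scheme T3UnitLawDensityEML.ℰp γ).β K * r ^ 2 / ((n : ℝ) ^ 2 * Λ ^ 2))))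
    (hR : open Literature.MathematicalPhysics.QuantumFieldTheory.Balaban1983to89 Literature.MathematicalPhysics.QuantumFieldTheory.Balaban1983to89.T3ContinuumYM3Torus in ∀ (L : ℕ), ∃ (Cc cc : ℝ), 0 ≤ Cc ∧ 0 < cc ∧ ∃ γ₁ : ℝ, 0 < γ₁ ∧ γ₁ ≤ 1 ∧ ∀ (F : T3Family) (γ : ℝ), F.L = L → 0 < γ → γ ≤ γ₁ → ∀ (K n : ℕ), 1 ≤ n → (n : ℝ) ≤ (F.scheme T3UnitLawDensityEML.ℰp γ).β K → 2 * n ≤ (F.P K).sitesPerDir 0 → 17 * L ^ 3 < n → ∀ (x₀ : Site (F.P K) 0) (f : GaugeField (F.P K) 0 (Matrix.specialUnitaryGroup (Fin 2) ℂ) → ℝ) (Λ : ℝ), 0 < Λ → Measurable f → GaugeField.GaugeInvariant f → (∀ U U' : GaugeField (F.P K) 0 (Matrix.specialUnitaryGroup (Fin 2) ℂ), (∀ b : PBond (F.P K) 0, (∀ k, (b.src k - x₀ k).val < n) → (∀ k, (b.tgt k - x₀ k).val < n) → U b = U' b) → f U = f U') → (∀ U U' : GaugeField (F.P K) 0 (Matrix.specialUnitaryGroup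 (Fin 2) ℂ), |f U - f U'| ≤ Λ * Real.sqrt (∑ b : PBond (F.P K) 0, GaugeGroup.dist1 (U b * (U' b)⁻¹) ^ 2)) → ∀ r : ℝ, 0 ≤ r → (T3UnitScaleTilt.gibbsK F T3UnitLawDensityEML.ℰp γ K).real {U | r ≤ f U - ∫ V, f V ∂(T3UnitScaleTilt.gibbsK F T3UnitLawDensityEML.ℰp γ K)} ≤ Cc * Real.exp (-(cc * (F.scheme T3UnitLawDensityEML.ℰp γ).β K * r ^ 2 / ((n : ℝ) ^ 2 * Λ ^ 2)))) :
    open Literature.MathematicalPhysics.QuantumFieldTheory.Balaban1983to89 Literature.MathematicalPhysics.QuantumFieldTheory.Balaban1983to89.T3ContinuumYM3Torus in ∀ (L : ℕ), ∃ (Cc cc : ℝ), 0 ≤ Cc ∧ 0 < cc ∧ ∃ γ₁ : ℝ, 0 < γ₁ ∧ γ₁ ≤ 1 ∧ ∀ (F : T3Family) (γ : ℝ), F.L = L → 0 < γ → γ ≤ γ₁ → ∀ (K n : ℕ), 1 ≤ n → (n : ℝ) ≤ (F.scheme T3UnitLawDensityEML.ℰp γ).β K → 2 * n ≤ (F.P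 K).sitesPerDir 0 → ∀ (x₀ : Site (F.P K) 0) (f : GaugeField (F.P K) 0 (Matrix.specialUnitaryGroup (Fin 2) ℂ) → ℝ) (Λ : ℝ), 0 < Λ → Measurable f → GaugeField.GaugeInvariant f → (∀ U U' : GaugeField (F.P K) 0 (Matrix.specialUnitaryGroup (Fin 2) ℂ), (∀ b : PBond (F.P K) 0, (∀ k, (b.src k - x₀ k).val < n) → (∀ k, (b.tgt k - x₀ k).val < n) → U b = U' b) → f U = f U') → (∀ U U' : GaugeField (F.P K) 0 (Matrix.specialUnitaryGroup (Fin 2) ℂ), |f U - f U'| ≤ Λ * Real.sqrt (∑ b : PBond (F.P K) 0, GaugeGroup.dist1 (U b * (U' b)⁻¹) ^ 2)) → ∀ r : ℝ, 0 ≤ r → (T3UnitScaleTilt.gibbsK F T3UnitLawDensityEML.ℰp γ K).real {U | r ≤ f U - ∫ V, f V ∂(T3UnitScaleTilt.gibbsK F T3UnitLawDensityEML.ℰp γ K)} ≤ Cc * Real.exp (-(cc * (F.scheme T3UnitLawDensityEML.ℰp γ).β K * r ^ 2 / ((n : ℝ) ^ 2 * Λ ^ 2))) := by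
  intro L
  obtain ⟨Cc₁, cc₁, hCc₁, hcc₁, γa, hγa, hγa1, H1⟩ := hbdd L
  obtain ⟨Cc₂, cc₂, hCc₂, hcc₂, γb, hγb, hγb1, H2⟩ := hR L
  refine ⟨max Cc₁ Cc₂, min cc₁ cc₂, le_max_of_le_left hCc₁, lt_min hcc₁ hcc₂, min γa γb, lt_min hγa hγb,
    (min_le_left _ _).trans hγa1, ?_⟩
  intro F γ hFL hγ hγle K n hn1 hnβ h2n x₀ f Λ hΛ hfm hfG hloc hlip r hr
  have hn1r : (1 : ℝ) ≤ (n : ℝ) := by exact_mod_cast hn1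
  have hβ0 : (0 : ℝ) ≤ (F.scheme ℰp γ).β K := by linarith [hn1r.trans hnβ]
  have hQ0 : 0 ≤ (F.scheme ℰp γ).β K * r ^ 2 / ((n : ℝ) ^ 2 * Λ ^ 2) := by positivity
  -- monotonicity in the constants
  have hmono : ∀ (C c : ℝ), C ≤ max Cc₁ Cc₂ → min cc₁ cc₂ ≤ c →
      C * Real.exp (-(c * (F.scheme ℰp γ).β K * r ^ 2 / ((n : ℝ) ^ 2 * Λ ^ 2)))
        ≤ max Cc₁ Cc₂ * Real.exp (-(min cc₁ cc₂ * (F.scheme ℰp γ).β K * r ^ 2 / ((n : ℝ) ^ 2 * Λ ^ 2))) := by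
    intro C c hC hc
    refine mul_le_mul hC ?_ (Real.exp_pos _).le ((hCc₁.trans (le_max_left _ _)))
    rw [Real.exp_le_exp, neg_le_neg_iff]
    have e1 : min cc₁ cc₂ * (F.scheme ℰp γ).β K * r ^ 2 / ((n : ℝ) ^ 2 * Λ ^ 2)
        = min cc₁ cc₂ * ((F.scheme ℰp γ).β K * r ^ 2 / ((n : ℝ) ^ 2 * Λ ^ 2)) := by ring
    have e2 : c * (F.scheme ℰp γ).β K * r ^ 2 / ((n : ℝ) ^ 2 * Λ ^ 2)
        = c * ((F.scheme ℰp γ).β K * r ^ 2 / ((n : ℝ) ^ 2 * Λ ^ 2)) := by ring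
    rw [e1, e2]
    exact mul_le_mul_of_nonneg_right hc hQ0
  by_cases hnL : n ≤ 17 * L ^ 3
  · exact (H1 F γ hFL hγ (hγle.trans (min_le_left _ _)) K n hn1 hnβ h2n hnL x₀ f Λ hΛ hfm hfG hloc hlip r hr).trans
      (hmono Cc₁ cc₁ (le_max_left _ _) (min_le_left _ _))
  · exact (H2 F γ hFL hγ (hγle.trans (min_le_right _ _)) K n hn1 hnβ h2n (not_le.mp hnL) x₀ f Λ hΛ hfm hfG hloc hlip r hr).trans
      (hmono Cc₂ cc₂ (le_max_right _ _) (min_le_right _ _))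

/-- **LINE 29's CONCLUSION BY NAME.**  The four stubs (three CombPeierls + the verbatim residual) ⟹ `PoincareLipschitz.MesoscopicConcentrationL`
(stmt-QuantumFields-23532).  NOT closed: every stub is a `sorry`. -/
theorem MesoscopicConcentrationL_of_stubs :
    Summit.QuantumFields.YangMills.Theses.PoincareLipschitz.MesoscopicConcentrationL := by
  have h := mesoscopicConcentrationL_of boundedBoxConcentration_of_stubs stub_mesoscopicBoxConcentration
  exact h

end Summit.QuantumFields.YangMills.Cruxes.HistoryTailL.CombPeierls
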